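import Summits.QuantumFields.YangMills.Theorems.SwapVirialDeficitSigmaTwistedMinusSectorCeiling
import Summits.QuantumFields.YangMills.Theorems.SwapVirialDeficitSigmaTwistedOddSectorEmpty
import Summits.QuantumFields.YangMills.Theorems.LuscherReductionTwistedTraceScalingSlowShadow
import HarnessLib

/-!
# The SIGNED four-leader events of the σ-glued ring, sector by sector: product-Haar ceilings `≤ C·s⁷` for all eight seam sectors
# (brick (B-v-a) of w2 g54's swap-ceiling plan; consumer of w2's ✓(B-iii)/(B-iv) and of LEAD g93's zero-sector ceiling; free-hands support of
# ⟨stmt-QuantumFields-24197⟩ `SwapVirialDeficit.SwapGluedStiffness`)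

The signed box ✓`SwapRingTwisted.swapBox_of_swapRingDeficit_le` confines the four leaders `(C₀, C₁, C₂, c)` of a history with `F^S_z ≤ u` to the
FROBENIUS event `E^F_z(s)`: `C_μ` pairwise commute up to `s` and `‖c·C_{σμ} − centreElem(z μ)·C_μ·c‖_F ≤ s` (`σ = (0 1)`, `s = 52L³√u`).  This file
bounds `Haar⁴(E^F_z(s))` for every `z ∈ (ℤ/2)³`:
* §1 the quaternion form of the signed letters (✓`ConstTube.norm_su2Quat_sub_le`: `‖q(A) − q(B)‖ ≤ ‖A − B‖_F`);
* §2 `z 2 = 1` (four sectors): `E^F_z(s) ⊆` w2's minus event ⇒ `≤ 8192·coneConst³·s⁸` (✓`haar_pi_sigmaTwisted_minus_le`);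
* §3 `z = (1,0,0), (0,1,0)`: `E^F_z(s) ⊆` w2's odd events ⇒ Haar mass `0` for `s < t₀` (✓`pi_haar_sigmaTwisted_odd_eq_zero(')`);
* §4 `z = 0`: `E^F_0(s) ⊆` the quaternion event of ✓`SigmaTwistedLetterFloor` (LEAD g93's ceiling `≤ C s⁷` is taken as the hypothesis `hceil0`);
  `z = (1,1,0)`: the reflection `C₁ ↦ −C₁` (product-Haar preserving) maps `E^F_{(1,1,0)}(s)` into the `z = 0` quaternion event;
* §5 ★★ `haar_real_signedEvent_le`: for EVERY `z`, `Haar⁴.real(E^F_z(s)) ≤ C_z·s⁷` on `(0, s₀]`, given `hceil0` (used only for `z ∈ {0, (1,1,0)}`);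
  ★ `haar_real_signedEvent_le_of_ne` — the six sectors `z ∉ {0, (1,1,0)}` UNCONDITIONALLY.
HONEST LABEL: finite-dimensional Haar-volume bookkeeping for the fixed-`L` prediction row of a DRAFT line; ⟨24197⟩ ⟨24194⟩ ⟨24497⟩ stay OPEN; the
Yang–Mills mass gap is NOT proved; no summit is proved by a line.  Seat ym-line-fcl-p3 g43 (cell ym-idea-1, free hands; `--supports
stmt-QuantumFields-24197`).  THEOREMS ONLY (0 `def`, 0 `sorry`), standard axioms.  References: [cite: tHooft1979]; [cite: Luscher1983, §2]; [folklore].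
-/

set_option autoImplicit false

noncomputable section

open MeasureTheory Quaternion Set
open scoped Quaternion ENNReal BigOperators Matrix
open Literature.MathematicalPhysics.QuantumLattice
open Literature.MathematicalPhysics.QuantumFieldTheory (haarProbability frobNorm)
open Literature.MathematicalPhysics.QuantumFieldTheory.Balaban1983to89.T4HaarSU2Translate (su2Quat_mul su2Quat_one measurable_su2Quat)
open Summit.QuantumFields.YangMills.Theorems.FemtoTransferGap (SU2 negOne)
open Summit.QuantumFields.YangMills.Theorems.FemtoTransferGap.TT (centreElem)
open Summit.QuantumFields.YangMills.Theorems.SwapTwistDeficit.ToronLog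
open Summit.QuantumFields.YangMills.Theorems.ToronValleyVolume.NearlyCommutingCeiling
open Summit.QuantumFields.YangMills.Theorems.SwapVirialDeficit.OddSectorNoFlat (su2Quat_negOne_mul)
open Summit.QuantumFields.YangMills.Theorems.SwapVirialDeficit.SigmaTwistedOddSectorEmpty
open Summit.QuantumFields.YangMills.Theorems.SwapVirialDeficit.SigmaTwistedMinusSectorCeiling
open Summit.QuantumFields.YangMills.Theorems.SwapVirialDeficit.SigmaTwistedLetterFloor (measurableSet_sigmaTwisted)
open Summit.QuantumFields.YangMills.Theorems.FemtoTransferGap.TwoLattice.ConstTube (norm_su2Quat_sub_le)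

namespace Summit.QuantumFields.YangMills.Theorems.SwapVirialDeficit.SwapRingSectors

/-! ## §1 From Frobenius to quaternion closeness; signed letters -/

/-- `q(centreElem true · A · B) = −q(A)·q(B)`. [folklore] -/
theorem su2Quat_centreElem_true_mul_mul (A B : SU2) : su2Quat (centreElem true * A * B) = -(su2Quat A * su2Quat B) := by
  rw [show centreElem true = negOne by simp [centreElem], mul_assoc, su2Quat_negOne_mul, su2Quat_mul]

/-- `q(centreElem false · A · B) = q(A)·q(B)`. [folklore] -/
theorem su2Quat_centreElem_false_mul_mul (A B : SU2) : su2Quat (centreElem false * A * B) = su2Quat A * su2Quat B := by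
  rw [show centreElem false = (1 : SU2) by simp [centreElem], one_mul, su2Quat_mul]

/-- Quaternion commutators from Frobenius commutators. [folklore] -/
theorem norm_quat_comm_le_of_frob {A B : SU2} {s : ℝ}
    (h : frobNorm (((A * B : SU2) : Matrix (Fin 2) (Fin 2) ℂ) - ((B * A : SU2) : Matrix (Fin 2) (Fin 2) ℂ)) ≤ s) :
    ‖su2Quat A * su2Quat B - su2Quat B * su2Quat A‖ ≤ s := by
  have h' := (norm_su2Quat_sub_le _ _).trans h
  rwa [su2Quat_mul, su2Quat_mul] at h'

/-- A `−`-signed intertwining relation in quaternion form. [folklore] -/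
theorem norm_quat_anti_le_of_frob {X Y A B : SU2} {s : ℝ}
    (h : frobNorm (((X * Y : SU2) : Matrix (Fin 2) (Fin 2) ℂ) - ((centreElem true * A * B : SU2) : Matrix (Fin 2) (Fin 2) ℂ)) ≤ s) :
    ‖su2Quat X * su2Quat Y + su2Quat A * su2Quat B‖ ≤ s := by
  have h' := (norm_su2Quat_sub_le _ _).trans h
  rwa [su2Quat_centreElem_true_mul_mul, su2Quat_mul, sub_neg_eq_add] at h'

/-- A `+`-signed intertwining relation in quaternion form. [folklore] -/
theorem norm_quat_inter_le_of_frob {X Y A B : SU2} {s : ℝ}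
    (h : frobNorm (((X * Y : SU2) : Matrix (Fin 2) (Fin 2) ℂ) - ((centreElem false * A * B : SU2) : Matrix (Fin 2) (Fin 2) ℂ)) ≤ s) :
    ‖su2Quat X * su2Quat Y - su2Quat A * su2Quat B‖ ≤ s := by
  have h' := (norm_su2Quat_sub_le _ _).trans h
  rwa [su2Quat_centreElem_false_mul_mul, su2Quat_mul] at h'

/-- A `z`-signed intertwining relation in quaternion form. [folklore] -/
theorem norm_quat_signed_le_of_frob {X Y A B : SU2} (b : Bool) {s : ℝ}
    (h : frobNorm (((X * Y : SU2) : Matrix (Fin 2) (Fin 2) ℂ) - ((centreElem b * A * B : SU2) : Matrix (Fin 2) (Fin 2) ℂ)) ≤ s) :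
    ‖su2Quat X * su2Quat Y - su2Quat (centreElem b) * su2Quat A * su2Quat B‖ ≤ s := by
  have h' := (norm_su2Quat_sub_le _ _).trans h
  rwa [su2Quat_mul, su2Quat_mul, su2Quat_mul] at h'

/-! ## §2 The four sectors `z 2 = 1`: the minus event -/

/-- ★ For `z 2 = true` the signed Frobenius event lies in w2's minus event with sign letter `centreElem (z 0)`. [cite: tHooft1979] -/
theorem signedEvent_subset_minus (z : Fin 3 → Bool) (h2 : z 2 = true) (s : ℝ) :
    {C : Fin 4 → SU2 |
      (∀ μ ν : Fin 3, frobNorm (((C (Fin.castSucc μ) * C (Fin.castSucc ν) : SU2) : Matrix (Fin 2) (Fin 2) ℂ) -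
        ((C (Fin.castSucc ν) * C (Fin.castSucc μ) : SU2) : Matrix (Fin 2) (Fin 2) ℂ)) ≤ s) ∧
      ∀ μ : Fin 3, frobNorm (((C (Fin.last 3) * C (Fin.castSucc (Equiv.swap (0 : Fin 3) 1 μ)) : SU2) : Matrix (Fin 2) (Fin 2) ℂ) -
        ((centreElem (z μ) * C (Fin.castSucc μ) * C (Fin.last 3) : SU2) : Matrix (Fin 2) (Fin 2) ℂ)) ≤ s} ⊆
    {C : Fin 4 → SU2 | ‖su2Quat (C 0) * su2Quat (C 2) - su2Quat (C 2) * su2Quat (C 0)‖ ≤ s ∧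
      ‖su2Quat (C 3) * su2Quat (C 2) + su2Quat (C 2) * su2Quat (C 3)‖ ≤ s ∧
        ‖su2Quat (C 3) * su2Quat (C 1) - su2Quat (centreElem (z 0)) * su2Quat (C 0) * su2Quat (C 3)‖ ≤ s} := by
  rintro C ⟨hA, hB⟩
  have c0 : (Fin.castSucc (0 : Fin 3) : Fin 4) = 0 := by decide
  have c1 : (Fin.castSucc (1 : Fin 3) : Fin 4) = 1 := by decide
  have c2 : (Fin.castSucc (2 : Fin 3) : Fin 4) = 2 := by decide
  have c3 : (Fin.last 3 : Fin 4) = 3 := by decide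
  have s0 : Equiv.swap (0 : Fin 3) 1 0 = 1 := Equiv.swap_apply_left _ _
  have s2 : Equiv.swap (0 : Fin 3) 1 2 = 2 := Equiv.swap_apply_of_ne_of_ne (by decide) (by decide)
  refine ⟨?_, ?_, ?_⟩
  · have h := hA 0 2
    rw [c0, c2] at h
    exact norm_quat_comm_le_of_frob h
  · have h := hB 2
    rw [s2, c2, c3, h2] at h
    exact norm_quat_anti_le_of_frob h
  · have h := hB 0
    rw [s0, c1, c0, c3] at h
    exact norm_quat_signed_le_of_frob (z 0) h

/-- ★ `z 2 = true`: `Haar⁴(E^F_z(s)) ≤ 8192·coneConst³·s⁸` for `0 < s ≤ 1`. [cite: tHooft1979] -/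
theorem haar_signedEvent_minus_le (z : Fin 3 → Bool) (h2 : z 2 = true) {s : ℝ} (hs : 0 < s) (hs1 : s ≤ 1) :
    (Measure.pi fun _ : Fin 4 => haarProbability SU2) {C : Fin 4 → SU2 |
      (∀ μ ν : Fin 3, frobNorm (((C (Fin.castSucc μ) * C (Fin.castSucc ν) : SU2) : Matrix (Fin 2) (Fin 2) ℂ) -
        ((C (Fin.castSucc ν) * C (Fin.castSucc μ) : SU2) : Matrix (Fin 2) (Fin 2) ℂ)) ≤ s) ∧
      ∀ μ : Fin 3, frobNorm (((C (Fin.last 3) * C (Fin.castSucc (Equiv.swap (0 : Fin 3) 1 μ)) : SU2) : Matrix (Fin 2) (Fin 2) ℂ) -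
        ((centreElem (z μ) * C (Fin.castSucc μ) * C (Fin.last 3) : SU2) : Matrix (Fin 2) (Fin 2) ℂ)) ≤ s} ≤
      ENNReal.ofReal (8192 * coneConst ^ 3 * s ^ 8) :=
  (measure_mono (signedEvent_subset_minus z h2 s)).trans (haar_pi_sigmaTwisted_minus_le (centreElem (z 0)) hs hs1)

/-! ## §3 The odd sectors `z = (1,0,0)` and `z = (0,1,0)`: empty events -/

/-- ★ `z 0 = true`, `z 1 = false`: the signed Frobenius event lies in w2's odd event. [cite: tHooft1979] -/
theorem signedEvent_subset_odd (z : Fin 3 → Bool) (h0 : z 0 = true) (h1 : z 1 = false) (s : ℝ) :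
    {C : Fin 4 → SU2 |
      (∀ μ ν : Fin 3, frobNorm (((C (Fin.castSucc μ) * C (Fin.castSucc ν) : SU2) : Matrix (Fin 2) (Fin 2) ℂ) -
        ((C (Fin.castSucc ν) * C (Fin.castSucc μ) : SU2) : Matrix (Fin 2) (Fin 2) ℂ)) ≤ s) ∧
      ∀ μ : Fin 3, frobNorm (((C (Fin.last 3) * C (Fin.castSucc (Equiv.swap (0 : Fin 3) 1 μ)) : SU2) : Matrix (Fin 2) (Fin 2) ℂ) -
        ((centreElem (z μ) * C (Fin.castSucc μ) * C (Fin.last 3) : SU2) : Matrix (Fin 2) (Fin 2) ℂ)) ≤ s} ⊆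
    {C : Fin 4 → SU2 | ‖su2Quat (C 0) * su2Quat (C 1) - su2Quat (C 1) * su2Quat (C 0)‖ ≤ s ∧
      ‖su2Quat (C 3) * su2Quat (C 1) + su2Quat (C 0) * su2Quat (C 3)‖ ≤ s ∧
        ‖su2Quat (C 3) * su2Quat (C 0) - su2Quat (C 1) * su2Quat (C 3)‖ ≤ s} := by
  rintro C ⟨hA, hB⟩
  have c0 : (Fin.castSucc (0 : Fin 3) : Fin 4) = 0 := by decide
  have c1 : (Fin.castSucc (1 : Fin 3) : Fin 4) = 1 := by decide
  have c3 : (Fin.last 3 : Fin 4) = 3 := by decide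
  have s0 : Equiv.swap (0 : Fin 3) 1 0 = 1 := Equiv.swap_apply_left _ _
  have s1 : Equiv.swap (0 : Fin 3) 1 1 = 0 := Equiv.swap_apply_right _ _
  refine ⟨?_, ?_, ?_⟩
  · have h := hA 0 1
    rw [c0, c1] at h
    exact norm_quat_comm_le_of_frob h
  · have h := hB 0
    rw [s0, c1, c0, c3, h0] at h
    exact norm_quat_anti_le_of_frob h
  · have h := hB 1
    rw [s1, c0, c1, c3, h1] at h
    exact norm_quat_inter_le_of_frob h

/-- ★ `z 0 = false`, `z 1 = true`: the signed Frobenius event lies in w2's mirrored odd event. [cite: tHooft1979] -/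
theorem signedEvent_subset_odd' (z : Fin 3 → Bool) (h0 : z 0 = false) (h1 : z 1 = true) (s : ℝ) :
    {C : Fin 4 → SU2 |
      (∀ μ ν : Fin 3, frobNorm (((C (Fin.castSucc μ) * C (Fin.castSucc ν) : SU2) : Matrix (Fin 2) (Fin 2) ℂ) -
        ((C (Fin.castSucc ν) * C (Fin.castSucc μ) : SU2) : Matrix (Fin 2) (Fin 2) ℂ)) ≤ s) ∧
      ∀ μ : Fin 3, frobNorm (((C (Fin.last 3) * C (Fin.castSucc (Equiv.swap (0 : Fin 3) 1 μ)) : SU2) : Matrix (Fin 2) (Fin 2) ℂ) -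
        ((centreElem (z μ) * C (Fin.castSucc μ) * C (Fin.last 3) : SU2) : Matrix (Fin 2) (Fin 2) ℂ)) ≤ s} ⊆
    {C : Fin 4 → SU2 | ‖su2Quat (C 0) * su2Quat (C 1) - su2Quat (C 1) * su2Quat (C 0)‖ ≤ s ∧
      ‖su2Quat (C 3) * su2Quat (C 1) - su2Quat (C 0) * su2Quat (C 3)‖ ≤ s ∧
        ‖su2Quat (C 3) * su2Quat (C 0) + su2Quat (C 1) * su2Quat (C 3)‖ ≤ s} := by
  rintro C ⟨hA, hB⟩
  have c0 : (Fin.castSucc (0 : Fin 3) : Fin 4) = 0 := by decide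
  have c1 : (Fin.castSucc (1 : Fin 3) : Fin 4) = 1 := by decide
  have c3 : (Fin.last 3 : Fin 4) = 3 := by decide
  have s0 : Equiv.swap (0 : Fin 3) 1 0 = 1 := Equiv.swap_apply_left _ _
  have s1 : Equiv.swap (0 : Fin 3) 1 1 = 0 := Equiv.swap_apply_right _ _
  refine ⟨?_, ?_, ?_⟩
  · have h := hA 0 1
    rw [c0, c1] at h
    exact norm_quat_comm_le_of_frob h
  · have h := hB 0
    rw [s0, c1, c0, c3, h0] at h
    exact norm_quat_inter_le_of_frob h
  · have h := hB 1
    rw [s1, c0, c1, c3, h1] at h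
    exact norm_quat_anti_le_of_frob h

/-- ★ `z = (1,0,·)` with `z 1 = false`… precisely `z 0 = true`, `z 1 = false`: the signed event is Haar-null for `s < t₀`. [cite: tHooft1979] -/
theorem haar_signedEvent_odd_eq_zero (z : Fin 3 → Bool) (h0 : z 0 = true) (h1 : z 1 = false) :
    ∃ t₀ : ℝ, 0 < t₀ ∧ ∀ s : ℝ, s < t₀ →
      (Measure.pi fun _ : Fin 4 => haarProbability SU2) {C : Fin 4 → SU2 |
        (∀ μ ν : Fin 3, frobNorm (((C (Fin.castSucc μ) * C (Fin.castSucc ν) : SU2) : Matrix (Fin 2) (Fin 2) ℂ) -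
          ((C (Fin.castSucc ν) * C (Fin.castSucc μ) : SU2) : Matrix (Fin 2) (Fin 2) ℂ)) ≤ s) ∧
        ∀ μ : Fin 3, frobNorm (((C (Fin.last 3) * C (Fin.castSucc (Equiv.swap (0 : Fin 3) 1 μ)) : SU2) : Matrix (Fin 2) (Fin 2) ℂ) -
          ((centreElem (z μ) * C (Fin.castSucc μ) * C (Fin.last 3) : SU2) : Matrix (Fin 2) (Fin 2) ℂ)) ≤ s} = 0 := by
  obtain ⟨t₀, ht₀, h⟩ := pi_haar_sigmaTwisted_odd_eq_zero
  exact ⟨t₀, ht₀, fun s hs => measure_mono_null (signedEvent_subset_odd z h0 h1 s) (h s hs)⟩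

/-- ★ `z 0 = false`, `z 1 = true`: the signed event is Haar-null for `s < t₀`. [cite: tHooft1979] -/
theorem haar_signedEvent_odd'_eq_zero (z : Fin 3 → Bool) (h0 : z 0 = false) (h1 : z 1 = true) :
    ∃ t₀ : ℝ, 0 < t₀ ∧ ∀ s : ℝ, s < t₀ →
      (Measure.pi fun _ : Fin 4 => haarProbability SU2) {C : Fin 4 → SU2 |
        (∀ μ ν : Fin 3, frobNorm (((C (Fin.castSucc μ) * C (Fin.castSucc ν) : SU2) : Matrix (Fin 2) (Fin 2) ℂ) -
          ((C (Fin.castSucc ν) * C (Fin.castSucc μ) : SU2) : Matrix (Fin 2) (Fin 2) ℂ)) ≤ s) ∧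
        ∀ μ : Fin 3, frobNorm (((C (Fin.last 3) * C (Fin.castSucc (Equiv.swap (0 : Fin 3) 1 μ)) : SU2) : Matrix (Fin 2) (Fin 2) ℂ) -
          ((centreElem (z μ) * C (Fin.castSucc μ) * C (Fin.last 3) : SU2) : Matrix (Fin 2) (Fin 2) ℂ)) ≤ s} = 0 := by
  obtain ⟨t₀, ht₀, h⟩ := pi_haar_sigmaTwisted_odd_eq_zero'
  exact ⟨t₀, ht₀, fun s hs => measure_mono_null (signedEvent_subset_odd' z h0 h1 s) (h s hs)⟩

/-! ## §4 The even sectors `z = 0` and `z = (1,1,0)`: reduction to the zero-sector quaternion event -/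

/-- ★ `z = 0`: the signed Frobenius event lies in the quaternion event of ✓`SigmaTwistedLetterFloor` / LEAD's ceiling. [folklore] -/
theorem signedEvent_subset_zero (z : Fin 3 → Bool) (h0 : z 0 = false) (h1 : z 1 = false) (h2 : z 2 = false) (s : ℝ) :
    {C : Fin 4 → SU2 |
      (∀ μ ν : Fin 3, frobNorm (((C (Fin.castSucc μ) * C (Fin.castSucc ν) : SU2) : Matrix (Fin 2) (Fin 2) ℂ) -
        ((C (Fin.castSucc ν) * C (Fin.castSucc μ) : SU2) : Matrix (Fin 2) (Fin 2) ℂ)) ≤ s) ∧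
      ∀ μ : Fin 3, frobNorm (((C (Fin.last 3) * C (Fin.castSucc (Equiv.swap (0 : Fin 3) 1 μ)) : SU2) : Matrix (Fin 2) (Fin 2) ℂ) -
        ((centreElem (z μ) * C (Fin.castSucc μ) * C (Fin.last 3) : SU2) : Matrix (Fin 2) (Fin 2) ℂ)) ≤ s} ⊆
    {C : Fin 4 → SU2 |
      (∀ μ ν : Fin 3, ‖su2Quat (C μ.castSucc) * su2Quat (C ν.castSucc) - su2Quat (C ν.castSucc) * su2Quat (C μ.castSucc)‖ ≤ s) ∧
        ∀ μ : Fin 3, ‖su2Quat (C (Fin.last 3)) * su2Quat (C (Equiv.swap (0 : Fin 3) 1 μ).castSucc) -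
          su2Quat (C μ.castSucc) * su2Quat (C (Fin.last 3))‖ ≤ s} := by
  rintro C ⟨hA, hB⟩
  have hz : ∀ μ : Fin 3, z μ = false := by
    intro μ; fin_cases μ <;> assumption
  refine ⟨fun μ ν => norm_quat_comm_le_of_frob (hA μ ν), fun μ => ?_⟩
  have h := hB μ
  rw [hz μ] at h
  exact norm_quat_inter_le_of_frob h

/-- Sign flips do not change the norm of a commutator (left letter flipped). [folklore] -/
theorem norm_comm_neg_left (x y : ℍ) : ‖(-x) * y - y * (-x)‖ = ‖x * y - y * x‖ := by
  rw [neg_mul, mul_neg, neg_sub_neg, norm_sub_rev]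

/-- Sign flips do not change the norm of a commutator (right letter flipped). [folklore] -/
theorem norm_comm_neg_right (x y : ℍ) : ‖x * (-y) - (-y) * x‖ = ‖x * y - y * x‖ := by
  rw [mul_neg, neg_mul, neg_sub_neg, norm_sub_rev]

/-- The quaternion of a conditionally sign-flipped letter. [folklore] -/
theorem su2Quat_ite_negOne_mul (p : Prop) [Decidable p] (X : SU2) :
    su2Quat ((if p then negOne else (1 : SU2)) * X) = if p then -su2Quat X else su2Quat X := by
  by_cases hp : p
  · rw [if_pos hp, if_pos hp, su2Quat_negOne_mul]
  · rw [if_neg hp, if_neg hp, one_mul]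

/-- ★ `z = (1,1,0)`: flipping the sign of `C 1` maps the signed Frobenius event into the zero-sector quaternion event. [cite: tHooft1979] -/
theorem signedEvent_subset_preimage_flip (z : Fin 3 → Bool) (h0 : z 0 = true) (h1 : z 1 = true) (h2 : z 2 = false) (s : ℝ) :
    {C : Fin 4 → SU2 |
      (∀ μ ν : Fin 3, frobNorm (((C (Fin.castSucc μ) * C (Fin.castSucc ν) : SU2) : Matrix (Fin 2) (Fin 2) ℂ) -
        ((C (Fin.castSucc ν) * C (Fin.castSucc μ) : SU2) : Matrix (Fin 2) (Fin 2) ℂ)) ≤ s) ∧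
      ∀ μ : Fin 3, frobNorm (((C (Fin.last 3) * C (Fin.castSucc (Equiv.swap (0 : Fin 3) 1 μ)) : SU2) : Matrix (Fin 2) (Fin 2) ℂ) -
        ((centreElem (z μ) * C (Fin.castSucc μ) * C (Fin.last 3) : SU2) : Matrix (Fin 2) (Fin 2) ℂ)) ≤ s} ⊆
    (fun C : Fin 4 → SU2 => fun i : Fin 4 => (if i = 1 then negOne else (1 : SU2)) * C i) ⁻¹'
    {C : Fin 4 → SU2 |
      (∀ μ ν : Fin 3, ‖su2Quat (C μ.castSucc) * su2Quat (C ν.castSucc) - su2Quat (C ν.castSucc) * su2Quat (C μ.castSucc)‖ ≤ s) ∧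
        ∀ μ : Fin 3, ‖su2Quat (C (Fin.last 3)) * su2Quat (C (Equiv.swap (0 : Fin 3) 1 μ).castSucc) -
          su2Quat (C μ.castSucc) * su2Quat (C (Fin.last 3))‖ ≤ s} := by
  rintro C ⟨hA, hB⟩
  have c0 : (Fin.castSucc (0 : Fin 3) : Fin 4) = 0 := by decide
  have c1 : (Fin.castSucc (1 : Fin 3) : Fin 4) = 1 := by decide
  have c2 : (Fin.castSucc (2 : Fin 3) : Fin 4) = 2 := by decide
  have c3 : (Fin.last 3 : Fin 4) = 3 := by decide
  have s0 : Equiv.swap (0 : Fin 3) 1 0 = 1 := Equiv.swap_apply_left _ _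
  have s1 : Equiv.swap (0 : Fin 3) 1 1 = 0 := Equiv.swap_apply_right _ _
  have s2 : Equiv.swap (0 : Fin 3) 1 2 = 2 := Equiv.swap_apply_of_ne_of_ne (by decide) (by decide)
  simp only [Set.mem_preimage, Set.mem_setOf_eq, su2Quat_ite_negOne_mul]
  refine ⟨fun μ ν => ?_, fun μ => ?_⟩
  · have h := norm_quat_comm_le_of_frob (hA μ ν)
    by_cases hμ : (Fin.castSucc μ : Fin 4) = 1 <;> by_cases hν : (Fin.castSucc ν : Fin 4) = 1 <;>
      simp only [hμ, hν, if_true, if_false, norm_comm_neg_left, norm_comm_neg_right] <;>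
      first | exact h | (rw [hμ] at h; exact h) | (rw [hν] at h; exact h) | (rw [hμ, hν] at h; exact h)
  · have hμ : μ = 0 ∨ μ = 1 ∨ μ = 2 := by fin_cases μ <;> simp
    rcases hμ with rfl | rfl | rfl
    · have h := hB 0
      rw [s0, c1, c0, c3, h0] at h
      have h' := norm_quat_anti_le_of_frob h
      rw [s0, c1, c0, c3, if_neg (show (3 : Fin 4) ≠ 1 by decide), if_pos rfl, if_neg (show (0 : Fin 4) ≠ 1 by decide), mul_neg,
        ← neg_add', norm_neg]
      exact h'
    · have h := hB 1
      rw [s1, c0, c1, c3, h1] at h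
      have h' := norm_quat_anti_le_of_frob h
      rw [s1, c0, c1, c3, if_neg (show (3 : Fin 4) ≠ 1 by decide), if_pos rfl, if_neg (show (0 : Fin 4) ≠ 1 by decide), neg_mul,
        sub_neg_eq_add]
      exact h'
    · have h := hB 2
      rw [s2, c2, c3, h2] at h
      have h' := norm_quat_inter_le_of_frob h
      rw [s2, c2, c3, if_neg (show (3 : Fin 4) ≠ 1 by decide), if_neg (show (2 : Fin 4) ≠ 1 by decide)]
      exact h'

/-- The coordinate sign flip `C 1 ↦ −C 1` preserves the product Haar measure. [folklore] -/
theorem measurePreserving_flip :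
    MeasurePreserving (fun C : Fin 4 → SU2 => fun i : Fin 4 => (if i = 1 then negOne else (1 : SU2)) * C i)
      (Measure.pi fun _ : Fin 4 => haarProbability SU2) (Measure.pi fun _ : Fin 4 => haarProbability SU2) := by
  haveI : (haarProbability SU2).IsMulLeftInvariant := by unfold haarProbability; infer_instance
  exact measurePreserving_pi (fun _ : Fin 4 => haarProbability SU2) (fun _ : Fin 4 => haarProbability SU2)
    fun i => measurePreserving_mul_left (haarProbability SU2) (if i = 1 then negOne else (1 : SU2))

/-- ★ `z = (1,1,0)`: `Haar⁴(E^F_z(s)) ≤ Haar⁴` of the zero-sector quaternion event. [cite: tHooft1979] -/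
theorem haar_signedEvent_flip_le (z : Fin 3 → Bool) (h0 : z 0 = true) (h1 : z 1 = true) (h2 : z 2 = false) (s : ℝ) :
    (Measure.pi fun _ : Fin 4 => haarProbability SU2) {C : Fin 4 → SU2 |
      (∀ μ ν : Fin 3, frobNorm (((C (Fin.castSucc μ) * C (Fin.castSucc ν) : SU2) : Matrix (Fin 2) (Fin 2) ℂ) -
        ((C (Fin.castSucc ν) * C (Fin.castSucc μ) : SU2) : Matrix (Fin 2) (Fin 2) ℂ)) ≤ s) ∧
      ∀ μ : Fin 3, frobNorm (((C (Fin.last 3) * C (Fin.castSucc (Equiv.swap (0 : Fin 3) 1 μ)) : SU2) : Matrix (Fin 2) (Fin 2) ℂ) -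
        ((centreElem (z μ) * C (Fin.castSucc μ) * C (Fin.last 3) : SU2) : Matrix (Fin 2) (Fin 2) ℂ)) ≤ s} ≤
    (Measure.pi fun _ : Fin 4 => haarProbability SU2) {C : Fin 4 → SU2 |
      (∀ μ ν : Fin 3, ‖su2Quat (C μ.castSucc) * su2Quat (C ν.castSucc) - su2Quat (C ν.castSucc) * su2Quat (C μ.castSucc)‖ ≤ s) ∧
        ∀ μ : Fin 3, ‖su2Quat (C (Fin.last 3)) * su2Quat (C (Equiv.swap (0 : Fin 3) 1 μ).castSucc) -
          su2Quat (C μ.castSucc) * su2Quat (C (Fin.last 3))‖ ≤ s} := by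
  refine (measure_mono (signedEvent_subset_preimage_flip z h0 h1 h2 s)).trans (le_of_eq ?_)
  exact measurePreserving_flip.measure_preimage (measurableSet_sigmaTwisted s).nullMeasurableSet

/-! ## §5 All eight sectors -/

/-- ★ **The six sectors `z ∉ {0, (1,1,0)}`, UNCONDITIONALLY**: `Haar⁴.real(E^F_z(s)) ≤ C·s⁷` on `(0, s₀]` (`C = 8192·coneConst³` for `z 2 = 1`,
`C = 0` for the two odd sectors). [cite: tHooft1979] -/
theorem haar_real_signedEvent_le_of_ne (z : Fin 3 → Bool) (hz : z 2 = true ∨ z 0 ≠ z 1) :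
    ∃ C : ℝ, 0 ≤ C ∧ ∃ s₀ : ℝ, 0 < s₀ ∧ ∀ s : ℝ, 0 < s → s ≤ s₀ →
      (Measure.pi fun _ : Fin 4 => haarProbability SU2).real {C : Fin 4 → SU2 |
        (∀ μ ν : Fin 3, frobNorm (((C (Fin.castSucc μ) * C (Fin.castSucc ν) : SU2) : Matrix (Fin 2) (Fin 2) ℂ) -
          ((C (Fin.castSucc ν) * C (Fin.castSucc μ) : SU2) : Matrix (Fin 2) (Fin 2) ℂ)) ≤ s) ∧
        ∀ μ : Fin 3, frobNorm (((C (Fin.last 3) * C (Fin.castSucc (Equiv.swap (0 : Fin 3) 1 μ)) : SU2) : Matrix (Fin 2) (Fin 2) ℂ) -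
          ((centreElem (z μ) * C (Fin.castSucc μ) * C (Fin.last 3) : SU2) : Matrix (Fin 2) (Fin 2) ℂ)) ≤ s} ≤ C * s ^ 7 := by
  by_cases h2 : z 2 = true
  · refine ⟨8192 * coneConst ^ 3, by have := coneConst_pos; positivity, 1, one_pos, fun s hs hs1 => ?_⟩
    have h := haar_signedEvent_minus_le z h2 hs hs1
    rw [measureReal_def]
    refine (ENNReal.toReal_le_of_le_ofReal (by have := coneConst_pos; positivity) h).trans ?_
    have hs7 : s ^ 8 ≤ s ^ 7 := pow_le_pow_of_le_one hs.le hs1 (by norm_num)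
    have hc : 0 ≤ 8192 * coneConst ^ 3 := by have := coneConst_pos; positivity
    exact mul_le_mul_of_nonneg_left hs7 hc
  · have hne : z 0 ≠ z 1 := hz.resolve_left h2
    by_cases h0 : z 0 = true
    · have h1 : z 1 = false := by
        cases h : z 1
        · rfl
        · exact absurd (h0.trans h.symm) hne
      obtain ⟨t₀, ht₀, h⟩ := haar_signedEvent_odd_eq_zero z h0 h1
      refine ⟨0, le_rfl, t₀ / 2, by positivity, fun s hs hs₀ => ?_⟩
      rw [measureReal_def, h s (by linarith), ENNReal.toReal_zero, zero_mul]
    · have h0' : z 0 = false := by cases h : z 0 <;> simp_all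
      have h1 : z 1 = true := by
        cases h : z 1
        · exact absurd (h0'.trans h.symm) hne
        · rfl
      obtain ⟨t₀, ht₀, h⟩ := haar_signedEvent_odd'_eq_zero z h0' h1
      refine ⟨0, le_rfl, t₀ / 2, by positivity, fun s hs hs₀ => ?_⟩
      rw [measureReal_def, h s (by linarith), ENNReal.toReal_zero, zero_mul]

/-- ★★ **ALL EIGHT SECTORS**: given the zero-sector ceiling `hceil0` (LEAD g93's `haar_pi_sigmaTwisted_le`, the quaternion event of
✓`SigmaTwistedLetterFloor`), `Haar⁴.real(E^F_z(s)) ≤ C_z·s⁷` on `(0, s₀]` for every `z`. [cite: tHooft1979] [cite: Luscher1983, §2] -/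
theorem haar_real_signedEvent_le
    (hceil0 : ∃ C : ℝ, 0 ≤ C ∧ ∃ t₀ : ℝ, 0 < t₀ ∧ ∀ t : ℝ, 0 < t → t ≤ t₀ →
      (Measure.pi fun _ : Fin 4 => haarProbability SU2).real {C : Fin 4 → SU2 |
        (∀ μ ν : Fin 3, ‖su2Quat (C μ.castSucc) * su2Quat (C ν.castSucc) - su2Quat (C ν.castSucc) * su2Quat (C μ.castSucc)‖ ≤ t) ∧
          ∀ μ : Fin 3, ‖su2Quat (C (Fin.last 3)) * su2Quat (C (Equiv.swap (0 : Fin 3) 1 μ).castSucc) -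
            su2Quat (C μ.castSucc) * su2Quat (C (Fin.last 3))‖ ≤ t} ≤ C * t ^ 7)
    (z : Fin 3 → Bool) :
    ∃ C : ℝ, 0 ≤ C ∧ ∃ s₀ : ℝ, 0 < s₀ ∧ ∀ s : ℝ, 0 < s → s ≤ s₀ →
      (Measure.pi fun _ : Fin 4 => haarProbability SU2).real {C : Fin 4 → SU2 |
        (∀ μ ν : Fin 3, frobNorm (((C (Fin.castSucc μ) * C (Fin.castSucc ν) : SU2) : Matrix (Fin 2) (Fin 2) ℂ) -
          ((C (Fin.castSucc ν) * C (Fin.castSucc μ) : SU2) : Matrix (Fin 2) (Fin 2) ℂ)) ≤ s) ∧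
        ∀ μ : Fin 3, frobNorm (((C (Fin.last 3) * C (Fin.castSucc (Equiv.swap (0 : Fin 3) 1 μ)) : SU2) : Matrix (Fin 2) (Fin 2) ℂ) -
          ((centreElem (z μ) * C (Fin.castSucc μ) * C (Fin.last 3) : SU2) : Matrix (Fin 2) (Fin 2) ℂ)) ≤ s} ≤ C * s ^ 7 := by
  by_cases hz : z 2 = true ∨ z 0 ≠ z 1
  · exact haar_real_signedEvent_le_of_ne z hz
  · push Not at hz
    obtain ⟨h2, h01⟩ := hz
    have h2' : z 2 = false := by cases h : z 2 <;> simp_all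
    obtain ⟨C, hC, t₀, ht₀, hceil⟩ := hceil0
    refine ⟨C, hC, t₀, ht₀, fun s hs hs₀ => (le_trans ?_ (hceil s hs hs₀))⟩
    by_cases h0 : z 0 = true
    · have h1 : z 1 = true := h01 ▸ h0
      exact (measureReal_mono (signedEvent_subset_preimage_flip z h0 h1 h2' s) (measure_ne_top _ _)).trans
        (le_of_eq (congrArg ENNReal.toReal
          (measurePreserving_flip.measure_preimage (measurableSet_sigmaTwisted s).nullMeasurableSet)))
    · have h0' : z 0 = false := by cases h : z 0 <;> simp_all
      have h1 : z 1 = false := h01 ▸ h0'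
      exact measureReal_mono (signedEvent_subset_zero z h0' h1 h2' s) (measure_ne_top _ _)

end Summit.QuantumFields.YangMills.Theorems.SwapVirialDeficit.SwapRingSectors

end
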